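/-
Copyright (c) 2026 the pub-hodgecm-mathlib formalisation cell (harness21).  Prover seat hodgecm-mathlib-K2Liu-p08 (g3): Track B «K2-LIT»,
hLiu418 = stmt-HodgeConjecture-24832; LEAD F0P6-plan (g13) RULING «M-157o» (#42S-S5 road (d)) and CUT (B) «CENTRAL RAY» of record
2026-09-04T09:52:40Z, file S5-W4 (ray form; the 400-line law forbids appending to ★ `K2LiuSingularSectionVanishes`).
-/
import Summits.HodgeConjecture.HodgeConjecture.Theorems.K2LiuSingularSectionVanishes   -- ★ S5-W4: §1 kill, §3 `exists_levi_scalar_mem_closure`, modulus letters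
import HarnessLib

/-!
# Crux `HLiu418`, road `K2_Liu`, #42S-S5, file S5-W4 (RAY FORM, cut (B)):
# THE KILL FROM RAY EIGEN-LAWS AT THE SCALAR LEVI ELEMENT — one or two eigenvalues

Cell `hodgecm-mathlib`, crux item hLiu418 = `stmt-HodgeConjecture-24832`; squad K2 ∕ K2Liu; prover K2Liu-p08 (g3).  THEOREMS ONLY (no `def`, no
instance, no notation, no named-fact hypothesis, no `sorry`); lane `--supports stmt-HodgeConjecture-24832 --as helper` (count-neutral helper).

WHY (LEAD F0P6-plan (g13) 09:52:40Z, cut (B) of record for S5).  The proof of ★ S5-W4 `K2LiuSingularSectionVanishes.eq_zero_of_isSiegelDeltaSection_of_weylDelta`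
uses the section law `F(p h) = δ_{χ,s}(p) F(h)` at ONE element only: the scalar Levi element `m(z(2)·1) ∈ ⟨w_Δ, N_Δ(𝔸)⟩`, which is CENTRAL in `M_Δ(𝔸)`.
So S5-F2 does not need the full `I₁(0)`-membership of `E⋆(0) = a(0)·φ₀ + M⋆(0)φ₀` (that would cost the global section law of the adelic intertwining
integral), only RAY EIGEN-LAWS of the two summands at `m(t·1)`: `φ₀ ∈ I(0,χ)` is a section, and `M⋆(0)φ₀(m(t·1) h) = κ(0)·M⋆(0)φ₀(h)` is F1b-ray
(`K2LiuIntertwiningCentralRayEigen`, centre scaling) transported by ★ F1b-β `K2LiuRankOneCentreContinuation.constTerm_sub_apply_mul_eq`.  The two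
eigenvalues may differ (by `χ(z(t))^{∓n}`); a Vandermonde step handles that.

CONTENTS.
* §1 `eq_zero_of_mem_closure_of_apply_mul_two` (any group, commutative codomain without zero divisors): `F = F₁ + F₂` left-invariant under `T`,
  `m ∈ Subgroup.closure T`, `F_i(m g) = c_i F_i(g)` with `c₁, c₂ ≠ 1` ⇒ `F = 0` (`c₁ = c₂`: ★ one-eigenvalue kill; `c₁ ≠ c₂`: compare `F`, `F(m·)`,
  `F(m²·)`).
* §2 `exists_centralRay_mem_closure`: for every `(c ⊗ 1)`-fixed unit `t ∈ 𝔸_L^×` the scalar Levi element `blk p = R (t•1, 0; 0, t⁻¹•1) R⁻¹` lies in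
  `closure({w_Δ} ∪ N_Δ(𝔸))` (★ `exists_levi_scalar_mem_closure` with `a = t·δ`, `b = δ`).
* §3 **`eq_zero_of_centralRay_eigen_two`** (two ray eigen-laws, `c₁, c₂ ≠ 1`) and **`eq_zero_of_isSiegelDeltaSection_add_centralRay_eigen`**
  (`F₁ ∈ I_n(s,χ)`, `χ` unitary, `2 Re s + n ≠ 0`, `t = z(r)`, `r ≠ 1`; `F₂` a ray eigenfunction with `c₂ ≠ 1`): `F = F₁ + F₂` left-`N_Δ(𝔸)`- and
  `w_Δ`-invariant ⇒ `F = 0`.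
HONEST LABEL.  `HC_CM` is proved only modulo the 7 printed citations (2 remaining named inputs: hLiu418 = `stmt-HodgeConjecture-24832`,
h413 = `stmt-HodgeConjecture-24833`) until rung 0 closes.

## References
* [JiangWu2016ChiB] D. Jiang, C. Wu, J. Number Theory 161 (2016), Prop. 4.1 (incoherence ⇒ no automorphic realisation).
* [MoeglinWaldspurger1995] C. Mœglin, J.-L. Waldspurger, *Spectral decomposition and Eisenstein series* (1995), I.2.1, II.1.7.
* [HarrisKudlaSweet1996] M. Harris, S. Kudla, W. J. Sweet, J. Amer. Math. Soc. 9 (1996), §1 (1.11)–(1.12).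
* [WeilBNT1967] A. Weil, *Basic Number Theory* (1967), Ch. IV §4.
-/

set_option autoImplicit false
set_option linter.dupNamespace false -- the mandated namespace repeats `HodgeConjecture.HodgeConjecture`

noncomputable section

open scoped Matrix NNReal
open NumberField IsDedekindDomain

namespace Summit.HodgeConjecture.HodgeConjecture.Cruxes.HLiu418.K2LiuSingularSectionVanishesRay

open Literature.NumberTheory.GelbartRogawski1991.AdaptedBlocks
open Literature.NumberTheory.Automorphic Literature.NumberTheory.Automorphic.UnitaryGroup
open Literature.NumberTheory.GelbartRogawski1991 Literature.NumberTheory.GelbartRogawski1991.GRConstruction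
open Literature.NumberTheory.K2Lit.SiegelDoubled Literature.NumberTheory.GaloisRepresentations
open UnitaryDualPair
open Summit.HodgeConjecture.HodgeConjecture.Cruxes.HLiu418.K2LiuSiegelDoubledLeviMatrix
open Summit.HodgeConjecture.HodgeConjecture.Cruxes.HLiu418.K2LiuSiegelEisensteinDoubledSummableReduction (norm_siegelDeltaCharacter)
open Summit.HodgeConjecture.HodgeConjecture.Cruxes.HLiu418.K2LiuSingularSectionVanishes

/-! ## §1 The two-eigenvalue kill -/

section AbstractTwo

variable {G : Type*} [Group G]

/-- **TWO-EIGENVALUE KILL (Vandermonde).**  `F = F₁ + F₂` is left-invariant under `T`; some `m ∈ Subgroup.closure T` acts on `F₁`, `F₂` by scalars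
`c₁, c₂ ≠ 1`: `F_i(m g) = c_i F_i(g)`.  Then `F = 0` (if `c₁ = c₂` this is ★ `eq_zero_of_mem_closure_of_apply_mul`; if `c₁ ≠ c₂`, comparing
`F = F(m ·) = F(m² ·)` gives `(c₁ − 1)(c₂ − c₁) F₁ = 0`, so `F₁ = F₂ = 0` pointwise).  [cite: JiangWu2016ChiB, Prop. 4.1] [cite: MoeglinWaldspurger1995, II.1.7] -/
theorem eq_zero_of_mem_closure_of_apply_mul_two {R : Type*} [CommRing R] [NoZeroDivisors R] {F F₁ F₂ : G → R} (hF : ∀ g, F g = F₁ g + F₂ g)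
    {T : Set G} (hT : ∀ t ∈ T, ∀ g, F (t * g) = F g) {m : G} (hm : m ∈ Subgroup.closure T) {c₁ c₂ : R} (hc₁ : c₁ ≠ 1) (hc₂ : c₂ ≠ 1)
    (h₁ : ∀ g, F₁ (m * g) = c₁ * F₁ g) (h₂ : ∀ g, F₂ (m * g) = c₂ * F₂ g) : F = 0 := by
  by_cases hc : c₁ = c₂
  · subst hc
    exact eq_zero_of_mem_closure_of_apply_mul F hT hm hc₁ fun g => by rw [hF, hF g, h₁, h₂, mul_add]
  · funext g
    have e1 : F₁ g + F₂ g = c₁ * F₁ g + c₂ * F₂ g := by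
      rw [← hF, ← h₁, ← h₂, ← hF, apply_mul_eq_of_mem_closure F hT hm]
    have e2 : F₁ g + F₂ g = c₁ * (c₁ * F₁ g) + c₂ * (c₂ * F₂ g) := by
      rw [← hF, ← h₁, ← h₁, ← h₂, ← h₂, ← hF, ← mul_assoc, apply_mul_eq_of_mem_closure F hT (mul_mem hm hm)]
    have h3 : (c₁ - 1) * (c₂ - c₁) * F₁ g = 0 := by linear_combination -(1 + c₂) * e1 + e2
    have hF₁ : F₁ g = 0 :=
      (mul_eq_zero.1 h3).resolve_left (mul_ne_zero (sub_ne_zero.2 hc₁) (sub_ne_zero.2 (Ne.symm hc)))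
    have h4 : (c₂ - 1) * F₂ g = 0 := by linear_combination (1 - c₁) * hF₁ - e1
    have hF₂ : F₂ g = 0 := (mul_eq_zero.1 h4).resolve_left (sub_ne_zero.2 hc₂)
    rw [hF, hF₁, hF₂, add_zero]
    rfl

end AbstractTwo

/-! ## §2 The scalar Levi element `m(t·1)` for a `(c ⊗ 1)`-fixed unit `t` lies in `⟨w_Δ, N_Δ(𝔸)⟩` -/

section Ray

variable (L : Type) [Field L] [NumberField L] [IsCMField L]
variable {N M n : ℕ} (e : Fin N × Fin M ≃ Fin n)
  (dV : Fin N → L) (hdV : ∀ i, IsCMField.complexConj L (dV i) = dV i)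
  (dW : Fin M → L) (hdW : ∀ i, IsCMField.complexConj L (dW i) = dW i)

/-- **`m(t·1) ∈ ⟨w_Δ, N_Δ(𝔸)⟩`** for every `(c ⊗ 1)`-fixed unit `t ∈ 𝔸_L^×` (e.g. `t = z(r)`, ★ `conjAdele_posRealIdele`): `∃ p ∈ closure({w_Δ} ∪ N_Δ(𝔸))` with
`blk p = R (t•1, 0; 0, t⁻¹•1) R⁻¹` (★ `exists_levi_scalar_mem_closure` with `a = t·δ`, `b = δ`, `δ ∈ L`, `c δ = −δ`).
[cite: HarrisKudlaSweet1996, §1 (1.11)–(1.12)] [cite: MoeglinWaldspurger1995, I.2.1] -/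
theorem exists_centralRay_mem_closure {t : (AdeleRing (𝓞 L) L)ˣ}
    (ht : conjAdele (Fp L) L (IsCMField.complexConj L) (t : AdeleRing (𝓞 L) L) = (t : AdeleRing (𝓞 L) L)) :
    ∃ p ∈ Subgroup.closure ({weylDelta L e dV hdV dW hdW} ∪ (unipDelta L e dV hdV dW hdW : Set (HA L e dV hdV dW hdW))),
      blk L e dV hdV dW hdW p =
        cayR (AdeleRing (𝓞 L) L) (Fin n) *
          Matrix.fromBlocks ((t : AdeleRing (𝓞 L) L) • (1 : Matrix (Fin n) (Fin n) (AdeleRing (𝓞 L) L))) 0 0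
            (((t⁻¹ : (AdeleRing (𝓞 L) L)ˣ) : AdeleRing (𝓞 L) L) • (1 : Matrix (Fin n) (Fin n) (AdeleRing (𝓞 L) L))) *
          cayRinv (AdeleRing (𝓞 L) L) (Fin n) := by
  obtain ⟨e₀, he₀⟩ := Literature.NumberTheory.NumberFields.IsCMField.exists_complexConj_ne L
  have hδ0 : e₀ - IsCMField.complexConj L e₀ ≠ 0 := sub_ne_zero.2 (Ne.symm he₀)
  have hδc : IsCMField.complexConj L (e₀ - IsCMField.complexConj L e₀) = -(e₀ - IsCMField.complexConj L e₀) := by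
    rw [map_sub, IsCMField.complexConj_apply_apply, neg_sub]
  set d : (AdeleRing (𝓞 L) L)ˣ := Units.map (algebraMap L (AdeleRing (𝓞 L) L) : L →* AdeleRing (𝓞 L) L)
    (Units.mk0 (e₀ - IsCMField.complexConj L e₀) hδ0) with hd
  have hσd : conjAdele (Fp L) L (IsCMField.complexConj L) (d : AdeleRing (𝓞 L) L) = -(d : AdeleRing (𝓞 L) L) := by
    change conjAdele (Fp L) L (IsCMField.complexConj L) (algebraMap L (AdeleRing (𝓞 L) L) (e₀ - IsCMField.complexConj L e₀)) =
      -(algebraMap L (AdeleRing (𝓞 L) L) (e₀ - IsCMField.complexConj L e₀))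
    rw [← algebraMap_conj (Fp L) L (IsCMField.complexConj L) (e₀ - IsCMField.complexConj L e₀), ← map_neg, ← hδc]
    rfl
  have hσa : conjAdele (Fp L) L (IsCMField.complexConj L) ((t * d : (AdeleRing (𝓞 L) L)ˣ) : AdeleRing (𝓞 L) L) =
      -((t * d : (AdeleRing (𝓞 L) L)ˣ) : AdeleRing (𝓞 L) L) := by
    rw [Units.val_mul, map_mul, ht, hσd, mul_neg]
  obtain ⟨p, hp_mem, hp⟩ := exists_levi_scalar_mem_closure L e dV hdV dW hdW hσa hσd
  rw [mul_inv_cancel_right, mul_inv_rev, inv_mul_cancel_comm] at hp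
  exact ⟨p, hp_mem, hp⟩

/-! ## §3 The kills in ray form -/

/-- **S5-W4, CUT (B) — THE KILL FROM TWO RAY EIGEN-LAWS.**  Let `t ∈ 𝔸_L^×` be `(c ⊗ 1)`-fixed (e.g. `t = z(2)`) and `F = F₁ + F₂ : H(𝔸) → ℂ` with
`F` left-invariant under `N_Δ(𝔸)` and under `w_Δ`, and suppose `F₁`, `F₂` are eigenfunctions of the scalar Levi element `m(t·1)` — for EVERY `p` of
that block shape (it is unique, ★ `blk_injective`) `F_i(p h) = c_i F_i(h)` — with `c₁, c₂ ≠ 1`.  Then `F = 0`.  (S5-F2: `F = E⋆(0)`, `F₁ = a(0)·φ₀`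
with `c₁ = δ_{χ,0}(m(t·1))`, `F₂ = M⋆(0)φ₀` with `c₂` = F1b-ray's `χ(t)^{−n}|t|^{n²∕2}`; both have norm `|t|_𝔸^{n²∕2} ≠ 1`.)
[cite: JiangWu2016ChiB, Prop. 4.1] [cite: MoeglinWaldspurger1995, II.1.7] [cite: HarrisKudlaSweet1996, §1 (1.11)] -/
theorem eq_zero_of_centralRay_eigen_two {t : (AdeleRing (𝓞 L) L)ˣ}
    (ht : conjAdele (Fp L) L (IsCMField.complexConj L) (t : AdeleRing (𝓞 L) L) = (t : AdeleRing (𝓞 L) L))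
    {F F₁ F₂ : HA L e dV hdV dW hdW → ℂ} (hF : ∀ h, F h = F₁ h + F₂ h)
    (hN : ∀ u ∈ unipDelta L e dV hdV dW hdW, ∀ h, F (u * h) = F h) (hw : ∀ h, F (weylDelta L e dV hdV dW hdW * h) = F h)
    {c₁ c₂ : ℂ} (hc₁ : c₁ ≠ 1) (hc₂ : c₂ ≠ 1)
    (h₁ : ∀ p : HA L e dV hdV dW hdW, blk L e dV hdV dW hdW p =
        cayR (AdeleRing (𝓞 L) L) (Fin n) *
          Matrix.fromBlocks ((t : AdeleRing (𝓞 L) L) • (1 : Matrix (Fin n) (Fin n) (AdeleRing (𝓞 L) L))) 0 0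
            (((t⁻¹ : (AdeleRing (𝓞 L) L)ˣ) : AdeleRing (𝓞 L) L) • (1 : Matrix (Fin n) (Fin n) (AdeleRing (𝓞 L) L))) *
          cayRinv (AdeleRing (𝓞 L) L) (Fin n) → ∀ h, F₁ (p * h) = c₁ * F₁ h)
    (h₂ : ∀ p : HA L e dV hdV dW hdW, blk L e dV hdV dW hdW p =
        cayR (AdeleRing (𝓞 L) L) (Fin n) *
          Matrix.fromBlocks ((t : AdeleRing (𝓞 L) L) • (1 : Matrix (Fin n) (Fin n) (AdeleRing (𝓞 L) L))) 0 0
            (((t⁻¹ : (AdeleRing (𝓞 L) L)ˣ) : AdeleRing (𝓞 L) L) • (1 : Matrix (Fin n) (Fin n) (AdeleRing (𝓞 L) L))) *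
          cayRinv (AdeleRing (𝓞 L) L) (Fin n) → ∀ h, F₂ (p * h) = c₂ * F₂ h) :
    F = 0 := by
  obtain ⟨p, hp_mem, hp⟩ := exists_centralRay_mem_closure L e dV hdV dW hdW ht
  refine eq_zero_of_mem_closure_of_apply_mul_two hF
    (T := {weylDelta L e dV hdV dW hdW} ∪ (unipDelta L e dV hdV dW hdW : Set (HA L e dV hdV dW hdW))) ?_ hp_mem hc₁ hc₂ (h₁ p hp) (h₂ p hp)
  rintro x hx h
  rcases hx with hx | hx
  · rw [Set.mem_singleton_iff.1 hx]
    exact hw h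
  · exact hN x hx h

/-- **S5-W4, CUT (B) — SECTION + RAY form.**  `F = F₁ + F₂` with `F₁ ∈ I_n(s, χ)` a Siegel section (`χ` unitary, `2 Re s + n ≠ 0`, `0 < n`; e.g.
`F₁ = a(0)·φ₀`), `F₂` an eigenfunction of the scalar Levi element `m(z(r)·1)` (`r ≠ 1`) with eigenvalue `c₂ ≠ 1` (e.g. `F₂ = M⋆(0)φ₀`, F1b-ray), `F`
left-`N_Δ(𝔸)`-invariant and `w_Δ`-invariant ⇒ `F = 0`.  The section's own ray eigenvalue `δ_{χ,s}(m(z(r)·1))` has norm `r^{n[L:ℚ](2Re s+n)∕2} ≠ 1`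
(★ `modDelta_of_blk_eq_levi_scalar`, ★ `norm_siegelDeltaCharacter`).  [cite: JiangWu2016ChiB, Prop. 4.1] [cite: MoeglinWaldspurger1995, II.1.7] [cite: WeilBNT1967, Ch. IV §4] -/
theorem eq_zero_of_isSiegelDeltaSection_add_centralRay_eigen (hn : 0 < n) {χ : HeckeCharacter L} (hχ : χ.IsUnitary) {s : ℂ}
    (hs : 2 * s.re + (n : ℝ) ≠ 0) {r : ℝ≥0ˣ} (hr : (r : ℝ≥0) ≠ 1)
    {F F₁ F₂ : HA L e dV hdV dW hdW → ℂ} (hF : ∀ h, F h = F₁ h + F₂ h) (hF₁ : IsSiegelDeltaSection L e dV hdV dW hdW χ s F₁)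
    (hN : ∀ u ∈ unipDelta L e dV hdV dW hdW, ∀ h, F (u * h) = F h) (hw : ∀ h, F (weylDelta L e dV hdV dW hdW * h) = F h)
    {c₂ : ℂ} (hc₂ : c₂ ≠ 1)
    (h₂ : ∀ p : HA L e dV hdV dW hdW, blk L e dV hdV dW hdW p =
        cayR (AdeleRing (𝓞 L) L) (Fin n) *
          Matrix.fromBlocks (((posRealIdele L r : (AdeleRing (𝓞 L) L)ˣ) : AdeleRing (𝓞 L) L) • (1 : Matrix (Fin n) (Fin n) (AdeleRing (𝓞 L) L))) 0 0
            ((((posRealIdele L r)⁻¹ : (AdeleRing (𝓞 L) L)ˣ) : AdeleRing (𝓞 L) L) • (1 : Matrix (Fin n) (Fin n) (AdeleRing (𝓞 L) L))) *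
          cayRinv (AdeleRing (𝓞 L) L) (Fin n) → ∀ h, F₂ (p * h) = c₂ * F₂ h) :
    F = 0 := by
  have ht : conjAdele (Fp L) L (IsCMField.complexConj L) ((posRealIdele L r : (AdeleRing (𝓞 L) L)ˣ) : AdeleRing (𝓞 L) L) =
      ((posRealIdele L r : (AdeleRing (𝓞 L) L)ˣ) : AdeleRing (𝓞 L) L) :=
    DoubledUnitary.RankOneReduction.conjAdele_posRealIdele (Fp L) L (IsCMField.complexConj L) r
  obtain ⟨p, hp_mem, hp⟩ := exists_centralRay_mem_closure L e dV hdV dW hdW ht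
  have hP : IsSiegelDelta L e dV hdV dW hdW p := isSiegelDelta_of_blk_eq_levi L e dV hdV dW hdW hp
  have hmod : modDelta L e dV hdV dW hdW p ≠ 1 := by
    rw [modDelta_of_blk_eq_levi_scalar L e dV hdV dW hdW hp]
    exact sqrt_ideleNorm_posRealIdele_pow_ne_one L hn hr
  have hc₁ : siegelDeltaCharacter L e dV hdV dW hdW χ s p ≠ 1 := by
    intro h1
    have hnorm := norm_siegelDeltaCharacter L e dV hdV dW hdW hχ s p
    have hpos := modDelta_pos L e dV hdV dW hdW p
    rw [h1, norm_one, Real.rpow_def_of_pos hpos, eq_comm, Real.exp_eq_one_iff, mul_eq_zero] at hnorm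
    rcases hnorm with hlog | hexp
    · exact hmod (Real.eq_one_of_pos_of_log_eq_zero hpos hlog)
    · exact hs hexp
  refine eq_zero_of_mem_closure_of_apply_mul_two hF
    (T := {weylDelta L e dV hdV dW hdW} ∪ (unipDelta L e dV hdV dW hdW : Set (HA L e dV hdV dW hdW))) ?_ hp_mem hc₁ hc₂ (hF₁ p hP) (h₂ p hp)
  rintro x hx h
  rcases hx with hx | hx
  · rw [Set.mem_singleton_iff.1 hx]
    exact hw h
  · exact hN x hx h

end Ray

end Summit.HodgeConjecture.HodgeConjecture.Cruxes.HLiu418.K2LiuSingularSectionVanishesRay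

end
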